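import Literature.LinearAlgebra.RootSystem.AffineWeylGroupLengthFormula
import HarnessLib

/-!
# Lengths of translations in `W_a`: dominant translations, `W`-invariance, `ℓ(w t(d)) = ℓ(w) + ℓ(t(d))` (Iwahori–Matsumoto 1965 §1.6)

N. Iwahori, H. Matsumoto, *On some Bruhat decomposition and the structure of the Hecke rings of p-adic Chevalley groups*, Publ. Math. IHÉS
25 (1965) [IwahoriMatsumoto1965] (held `paper:doi-10-1007-bf02684396`, PDF pp. 17–18 = journal pp. 252–253), §1.6 Proposition 1.23:
«Let `d ∈ P`, `w ∈ W`. `λ(T(d)w) = Σ_{α∈Δ⁺, w⁻¹(α)>0} |(α, d)| + Σ_{α∈Δ⁺, w⁻¹(α)<0} |(α, d) - 1|`»; proof of Proposition 1.25 (p. 253), for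
`d ∈ P⁺`: «Thus we get by Prop. 1.23, `λ(T(d)w*) = Σ_{α∈Δ₁}(|(α,d)| + 1) + Σ_{α∈Δ₂}|(α,d)|` … `λ(T(d)w*w) = λ(T(d)w*) - n(w)` … Similarly we get
`λ(T(d)w″w) = λ(T(d)w″) + n(w)` for any `w ∈ W`.»

THIS FILE (lane `lit-hodgefound`, prover seat p40, generation 45, row g45-#6; THEOREMS ONLY — no definition, instance, notation or named fact;
net debt 0) draws the standard consequences of row g45-#4 (`AffineWeylGroupLengthFormula`: Prop. 1.23 for p13's word length `ℓ` on `W_a` in the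
generators `S_a`, `length_constVAdd_mul_affineHom_eq`, `length_constVAdd_eq`, `length_affineHom_eq_card_filter`) for translations `t(d)`, `d` in
the root lattice `Q` with integer levels `m_α = ⟨d, α^∨⟩`; «dominant» = `m_α ≥ 0` for every positive `α`, «regular dominant» = `m_α ≥ 1`.
Conventions of the `AffineWeylGroup*` files (weight space `M`, coroot levels).

* §1 ★★ `length_constVAdd_eq_sum_of_dominant` — `ℓ(t(d)) = Σ_{α>0} ⟨d, α^∨⟩` for dominant `d` (Prop. 1.23 with `w = 1`, no absolute values);
  ★★ `length_constVAdd_add_of_dominant` — ADDITIVITY ON THE DOMINANT CONE `ℓ(t(d + d')) = ℓ(t(d)) + ℓ(t(d'))`; ★★ `length_constVAdd_smul_eq` —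
  `W`-INVARIANCE `ℓ(t(gd)) = ℓ(t(d))` for `g ∈ Aut P` (`α ↦ g⁻¹α` permutes the roots, the halving lemma of row g45-#4).
* §2 ★★★ `length_affineHom_mul_constVAdd_of_dominant` — `ℓ(g·t(d)) = ℓ(g) + ℓ(t(d))` for `g ∈ W` and dominant `d` (Prop. 1.23 applied to the
  inverse `t(-d)g⁻¹`: every level `-m_α ≤ 0` contributes `m_α`, plus `1` exactly when `gα < 0`; cf. «`λ(T(d)w″w) = λ(T(d)w″) + n(w)`»).
* §3 ★★ `length_constVAdd_mul_affineHom_add_of_regular_dominant` — `ℓ(t(d)·g) + ℓ(g) = ℓ(t(d))` for `g ∈ W` and regular dominant `d`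
  (Prop. 1.23 directly: the roots with `g⁻¹α < 0` contribute `m_α - 1`; cf. «`λ(T(d)w*w) = λ(T(d)w*) - n(w)`»).

BY NAME, nothing restated: row g45-#4 (`length_constVAdd_mul_affineHom_eq`, `length_constVAdd_eq`, `length_affineHom_eq_card_filter`,
`sum_eq_two_mul_sum_filter_isPos`), g45-#1 (`wallReflection`, `isPreCoxeterSystem_affineWeylGroup`), g44-#1 (`affineHom`,
`constVAdd_mem_affineWeylGroup_of_mem_rootSpan`, `affineHom_mem_affineWeylGroup`, `smul_mem_rootSpan`, `mul_constVAdd`), `WeylGroupSimpleReflections`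
(`coroot'_smul_smul`; cf. `MinusculeWeights.coroot'_smul_eq`); seat p13 `IsPreCoxeterSystem.length_inv`; Mathlib `AffineEquiv.constVAdd_symm`, `Finset.card_filter`, `Equiv.sum_comp`.

## References

* [IwahoriMatsumoto1965] N. Iwahori, H. Matsumoto, Publ. Math. IHÉS 25 (1965) 5–48, §1.6 Proposition 1.23 (p. 252) and the proof of
  Proposition 1.25 (p. 253).
* [Humphreys1990] J. E. Humphreys, *Reflection Groups and Coxeter Groups*, CUP (1990), §4.4–4.5 (`n = ℓ` on `W_a`).
* [Bourbaki2002LieGroups46] N. Bourbaki, *Lie Groups and Lie Algebras, Chapters 4–6*, Ch. VI §2 (cite-only).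
-/

noncomputable section

open Module Set Function
open Literature.GroupTheory.Coxeter Literature.GroupTheory.Coxeter.PreCoxeterSystem

namespace Literature.LinearAlgebra.RootSystem

namespace Base

variable {ι K M N : Type*} [Field K] [LinearOrder K] [IsStrictOrderedRing K] [AddCommGroup M] [Module K M]
  [AddCommGroup N] [Module K N] [Fintype ι] [DecidableEq ι]
  {P : RootPairing ι K M N} [CharZero K] [P.IsCrystallographic] [P.IsReduced] (b : P.Base)

/-! ## §1 Dominant translations; `W`-invariance -/

section Dominant

/-- ★★ **`ℓ(t(d)) = Σ_{α>0} ⟨d, α^∨⟩` FOR A DOMINANT ROOT-LATTICE VECTOR** (`⟨d, α^∨⟩ ≥ 0` for all `α > 0`). [cite: IwahoriMatsumoto1965, §1.6 Proposition 1.23 (w = 1, d ∈ P⁺) and proof of Proposition 1.25] -/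
theorem length_constVAdd_eq_sum_of_dominant [Nonempty ι] [DecidablePred b.IsPos] {η : ι}
    (hη : ∀ k, P.coroot η - P.coroot k ∈ AddSubmonoid.closure (P.coroot '' (b.support : Set ι))) {d : M} (hd : d ∈ P.rootSpan ℤ)
    {m : ι → ℤ} (hm : ∀ i, P.coroot' i d = m i) (hdom : ∀ i, b.IsPos i → 0 ≤ m i) :
    (PreCoxeterSystem.length (wallReflection b η)
        ⟨AffineEquiv.constVAdd K M d, constVAdd_mem_affineWeylGroup_of_mem_rootSpan P hd⟩ : ℤ) =
      ∑ i ∈ Finset.univ.filter b.IsPos, m i := by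
  rw [length_constVAdd_eq b hη hd hm]
  exact Finset.sum_congr rfl fun i hi ↦ abs_of_nonneg (hdom i (Finset.mem_filter.mp hi).2)

/-- ★★ **ADDITIVITY ON THE DOMINANT CONE: `ℓ(t(d + d')) = ℓ(t(d)) + ℓ(t(d'))`** for dominant `d, d'` in the root lattice. [cite: IwahoriMatsumoto1965, §1.6 Proposition 1.23] -/
theorem length_constVAdd_add_of_dominant [Nonempty ι] [DecidablePred b.IsPos] {η : ι}
    (hη : ∀ k, P.coroot η - P.coroot k ∈ AddSubmonoid.closure (P.coroot '' (b.support : Set ι))) {d d' : M} (hd : d ∈ P.rootSpan ℤ)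
    (hd' : d' ∈ P.rootSpan ℤ) {m m' : ι → ℤ} (hm : ∀ i, P.coroot' i d = m i) (hm' : ∀ i, P.coroot' i d' = m' i)
    (hdom : ∀ i, b.IsPos i → 0 ≤ m i) (hdom' : ∀ i, b.IsPos i → 0 ≤ m' i) :
    PreCoxeterSystem.length (wallReflection b η)
        ⟨AffineEquiv.constVAdd K M (d + d'), constVAdd_mem_affineWeylGroup_of_mem_rootSpan P (Submodule.add_mem _ hd hd')⟩ =
      PreCoxeterSystem.length (wallReflection b η)
          ⟨AffineEquiv.constVAdd K M d, constVAdd_mem_affineWeylGroup_of_mem_rootSpan P hd⟩ +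
        PreCoxeterSystem.length (wallReflection b η)
          ⟨AffineEquiv.constVAdd K M d', constVAdd_mem_affineWeylGroup_of_mem_rootSpan P hd'⟩ := by
  have hmm : ∀ i, P.coroot' i (d + d') = ((m i + m' i : ℤ) : K) := fun i ↦ by rw [map_add, hm, hm', Int.cast_add]
  have h := length_constVAdd_eq_sum_of_dominant b hη (Submodule.add_mem _ hd hd') hmm fun i hi ↦ add_nonneg (hdom i hi) (hdom' i hi)
  rw [Finset.sum_add_distrib, ← length_constVAdd_eq_sum_of_dominant b hη hd hm hdom,
    ← length_constVAdd_eq_sum_of_dominant b hη hd' hm' hdom'] at h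
  exact_mod_cast h

omit [LinearOrder K] [IsStrictOrderedRing K] [Fintype ι] [DecidableEq ι] [CharZero K] [P.IsCrystallographic] [P.IsReduced] in
/-- The levels of `g·d` are those of `d` permuted: `⟨gd, α^∨⟩ = ⟨d, (g⁻¹α)^∨⟩` (the tree's `coroot'_smul_eq` of `MinusculeWeights`, in the
`g⁻¹ • i` spelling). [folklore] -/
private theorem coroot'_smul_eq_inv_smul (g : P.Aut) (d : M) (i : ι) : P.coroot' i (g • d) = P.coroot' (g⁻¹ • i) d := by
  conv_lhs => rw [← smul_inv_smul g i]
  exact coroot'_smul_smul g (g⁻¹ • i) d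

omit [LinearOrder K] [IsStrictOrderedRing K] [Fintype ι] [DecidableEq ι] [CharZero K] [P.IsCrystallographic] [P.IsReduced] in
/-- An automorphism of `P` commutes with `α ↦ -α` on indices. [folklore] -/
private theorem smul_reflectionPerm_self' (g : P.Aut) (i : ι) :
    g • P.reflectionPerm i i = P.reflectionPerm (g • i) (g • i) := by
  apply P.root.injective
  rw [smul_index_eq, smul_index_eq, RootPairing.Equiv.root_indexEquiv_eq_smul, RootPairing.root_reflectionPerm,
    RootPairing.root_reflectionPerm, RootPairing.reflection_apply_self, RootPairing.reflection_apply_self, smul_neg,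
    RootPairing.Equiv.root_indexEquiv_eq_smul]

/-- ★★ **`W`-INVARIANCE OF THE TRANSLATION LENGTH: `ℓ(t(gd)) = ℓ(t(d))`** for `g ∈ Aut P` and `d` in the root lattice (the multiset of
`|⟨d, α^∨⟩|` over all roots is permuted by `α ↦ g⁻¹α`). [cite: IwahoriMatsumoto1965, §1.6 Proposition 1.23 and §1.7 ("λ(ρσρ') = λ(σ)")] -/
theorem length_constVAdd_smul_eq [Nonempty ι] [DecidablePred b.IsPos] {η : ι}
    (hη : ∀ k, P.coroot η - P.coroot k ∈ AddSubmonoid.closure (P.coroot '' (b.support : Set ι))) (g : P.Aut) {d : M}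
    (hd : d ∈ P.rootSpan ℤ) :
    PreCoxeterSystem.length (wallReflection b η)
        ⟨AffineEquiv.constVAdd K M (g • d), constVAdd_mem_affineWeylGroup_of_mem_rootSpan P (smul_mem_rootSpan P g hd)⟩ =
      PreCoxeterSystem.length (wallReflection b η)
        ⟨AffineEquiv.constVAdd K M d, constVAdd_mem_affineWeylGroup_of_mem_rootSpan P hd⟩ := by
  obtain ⟨m, hm, hmneg⟩ := exists_coroot'_eq_intCast_of_mem_weightLattice
    (rootSpan_le_weightLattice P ((Submodule.mem_toAddSubgroup _).mpr hd))
  have hm' : ∀ i, P.coroot' i (g • d) = ((m (g⁻¹ • i) : ℤ) : K) := fun i ↦ by rw [coroot'_smul_eq_inv_smul, hm]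
  have h1 := length_constVAdd_eq b hη (smul_mem_rootSpan P g hd) hm'
  have h2 := length_constVAdd_eq b hη hd hm
  -- both sums are half of a sum over all roots, and `α ↦ g⁻¹α` is a permutation of the roots
  have h3 : ∑ i, |m (g⁻¹ • i)| = ∑ i, |m i| :=
    Equiv.sum_comp (MulAction.toPerm (g⁻¹ : P.Aut)) (fun i ↦ |m i|)
  have h4 := sum_eq_two_mul_sum_filter_isPos b (fun i ↦ |m (g⁻¹ • i)|) fun i ↦ by
    simp only [smul_reflectionPerm_self', hmneg, abs_neg]
  have h5 := sum_eq_two_mul_sum_filter_isPos b (fun i ↦ |m i|) fun i ↦ by simp only [hmneg, abs_neg]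
  have h6 : (PreCoxeterSystem.length (wallReflection b η)
      ⟨AffineEquiv.constVAdd K M (g • d), constVAdd_mem_affineWeylGroup_of_mem_rootSpan P (smul_mem_rootSpan P g hd)⟩ : ℤ) =
      PreCoxeterSystem.length (wallReflection b η)
        ⟨AffineEquiv.constVAdd K M d, constVAdd_mem_affineWeylGroup_of_mem_rootSpan P hd⟩ := by
    rw [h1, h2]; linarith
  exact_mod_cast h6

end Dominant

/-! ## §2 `ℓ(g t(d)) = ℓ(g) + ℓ(t(d))` for dominant `d` -/

section LeftW

/-- ★★★ **`ℓ(g · t(d)) = ℓ(g) + ℓ(t(d))` FOR `g ∈ W` AND DOMINANT `d ∈ Q`** — lengths add when a finite Weyl group element is followed by a dominant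
translation (Prop. 1.23 for the inverse `t(-d) g⁻¹`: each positive root contributes `|{-m_α}| = m_α` if `gα > 0` and `|-m_α - 1| = m_α + 1` if
`gα < 0`, and `#{α > 0 : gα < 0} = n(g) = ℓ(g)`, row g45-#4 Cor. 1.24). [cite: IwahoriMatsumoto1965, §1.6 Proposition 1.23 and proof of Proposition 1.25 ("λ(T(d)w″w) = λ(T(d)w″) + n(w)")] -/
theorem length_affineHom_mul_constVAdd_of_dominant [Nonempty ι] [DecidablePred b.IsPos] {η : ι}
    (hη : ∀ k, P.coroot η - P.coroot k ∈ AddSubmonoid.closure (P.coroot '' (b.support : Set ι))) {g : P.Aut} (hg : g ∈ P.weylGroup)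
    {d : M} (hd : d ∈ P.rootSpan ℤ) {m : ι → ℤ} (hm : ∀ i, P.coroot' i d = m i) (hdom : ∀ i, b.IsPos i → 0 ≤ m i) :
    PreCoxeterSystem.length (wallReflection b η)
        ⟨affineHom P g * AffineEquiv.constVAdd K M d,
          Subgroup.mul_mem _ (affineHom_mem_affineWeylGroup P hg) (constVAdd_mem_affineWeylGroup_of_mem_rootSpan P hd)⟩ =
      PreCoxeterSystem.length (wallReflection b η) ⟨affineHom P g, affineHom_mem_affineWeylGroup P hg⟩ +
        PreCoxeterSystem.length (wallReflection b η)
          ⟨AffineEquiv.constVAdd K M d, constVAdd_mem_affineWeylGroup_of_mem_rootSpan P hd⟩ := by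
  have hg' : g⁻¹ ∈ P.weylGroup := Subgroup.inv_mem _ hg
  have hd' : -d ∈ P.rootSpan ℤ := Submodule.neg_mem _ hd
  have hm' : ∀ i, P.coroot' i (-d) = ((-m i : ℤ) : K) := fun i ↦ by rw [map_neg, hm, Int.cast_neg]
  -- the inverse of `g t(d)` is `t(-d) g⁻¹`
  have hinv : (⟨affineHom P g * AffineEquiv.constVAdd K M d,
      Subgroup.mul_mem _ (affineHom_mem_affineWeylGroup P hg) (constVAdd_mem_affineWeylGroup_of_mem_rootSpan P hd)⟩ : affineWeylGroup P)⁻¹ =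
      ⟨AffineEquiv.constVAdd K M (-d) * affineHom P g⁻¹,
        Subgroup.mul_mem _ (constVAdd_mem_affineWeylGroup_of_mem_rootSpan P hd') (affineHom_mem_affineWeylGroup P hg')⟩ := by
    apply Subtype.ext
    rw [Subgroup.coe_inv]
    show (affineHom P g * AffineEquiv.constVAdd K M d)⁻¹ = AffineEquiv.constVAdd K M (-d) * affineHom P g⁻¹
    rw [mul_inv_rev, map_inv, AffineEquiv.inv_def (AffineEquiv.constVAdd K M d), AffineEquiv.constVAdd_symm]
  have h1 := length_constVAdd_mul_affineHom_eq b hη hd' hg' hm'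
  rw [← hinv, (isPreCoxeterSystem_affineWeylGroup b hη).length_inv] at h1
  simp only [inv_inv] at h1
  -- evaluate the summands: `|-m| = m`, `|-m - 1| = m + 1`
  have h2 : ∀ i ∈ Finset.univ.filter b.IsPos, (if b.IsPos (g • i) then |(-m i : ℤ)| else |(-m i : ℤ) - 1|) =
      m i + (if ¬ b.IsPos (g • i) then 1 else 0) := by
    intro i hi
    have h0 := hdom i (Finset.mem_filter.mp hi).2
    by_cases hgi : b.IsPos (g • i)
    · rw [if_pos hgi, if_neg (not_not.mpr hgi), abs_neg, abs_of_nonneg h0, add_zero]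
    · rw [if_neg hgi, if_pos hgi, show (-m i : ℤ) - 1 = -(m i + 1) by ring, abs_neg, abs_of_nonneg (by linarith)]
  rw [Finset.sum_congr rfl h2, Finset.sum_add_distrib] at h1
  have h3 : (∑ i ∈ Finset.univ.filter b.IsPos, (if ¬ b.IsPos (g • i) then (1 : ℤ) else 0)) =
      (((Finset.univ.filter b.IsPos).filter (fun i ↦ ¬ b.IsPos (g • i))).card : ℤ) := by
    rw [Finset.card_filter, Nat.cast_sum]
    exact Finset.sum_congr rfl fun i _ ↦ by split_ifs <;> simp
  rw [h3, ← length_affineHom_eq_card_filter b hη hg, ← length_constVAdd_eq_sum_of_dominant b hη hd hm hdom] at h1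
  have h4 : (PreCoxeterSystem.length (wallReflection b η)
      ⟨affineHom P g * AffineEquiv.constVAdd K M d,
        Subgroup.mul_mem _ (affineHom_mem_affineWeylGroup P hg) (constVAdd_mem_affineWeylGroup_of_mem_rootSpan P hd)⟩ : ℤ) =
      PreCoxeterSystem.length (wallReflection b η) ⟨affineHom P g, affineHom_mem_affineWeylGroup P hg⟩ +
        PreCoxeterSystem.length (wallReflection b η)
          ⟨AffineEquiv.constVAdd K M d, constVAdd_mem_affineWeylGroup_of_mem_rootSpan P hd⟩ := by
    rw [h1]; ring
  exact_mod_cast h4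

/-- The same for the translation by `gd` followed by `g`: `ℓ(t(gd)·g) = ℓ(g) + ℓ(t(d))` (`g t(d) = t(gd) g`). [cite: IwahoriMatsumoto1965, §1.6 Proposition 1.23] -/
theorem length_constVAdd_smul_mul_affineHom_of_dominant [Nonempty ι] [DecidablePred b.IsPos] {η : ι}
    (hη : ∀ k, P.coroot η - P.coroot k ∈ AddSubmonoid.closure (P.coroot '' (b.support : Set ι))) {g : P.Aut} (hg : g ∈ P.weylGroup)
    {d : M} (hd : d ∈ P.rootSpan ℤ) {m : ι → ℤ} (hm : ∀ i, P.coroot' i d = m i) (hdom : ∀ i, b.IsPos i → 0 ≤ m i) :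
    PreCoxeterSystem.length (wallReflection b η)
        ⟨AffineEquiv.constVAdd K M (g • d) * affineHom P g,
          Subgroup.mul_mem _ (constVAdd_mem_affineWeylGroup_of_mem_rootSpan P (smul_mem_rootSpan P g hd)) (affineHom_mem_affineWeylGroup P hg)⟩ =
      PreCoxeterSystem.length (wallReflection b η) ⟨affineHom P g, affineHom_mem_affineWeylGroup P hg⟩ +
        PreCoxeterSystem.length (wallReflection b η)
          ⟨AffineEquiv.constVAdd K M d, constVAdd_mem_affineWeylGroup_of_mem_rootSpan P hd⟩ := by
  rw [← length_affineHom_mul_constVAdd_of_dominant b hη hg hd hm hdom]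
  congr 1
  apply Subtype.ext
  show AffineEquiv.constVAdd K M (g • d) * affineHom P g = affineHom P g * AffineEquiv.constVAdd K M d
  rw [mul_constVAdd]
  rfl

end LeftW

/-! ## §3 `ℓ(t(d) g) = ℓ(t(d)) - ℓ(g)` for regular dominant `d` -/

section RightW

/-- ★★ **`ℓ(t(d)·g) + ℓ(g) = ℓ(t(d))` FOR `g ∈ W` AND REGULAR DOMINANT `d ∈ Q`** (`⟨d, α^∨⟩ ≥ 1` for all `α > 0`): by Prop. 1.23 the roots with
`g⁻¹α > 0` contribute `m_α` and those with `g⁻¹α < 0` contribute `m_α - 1`, and `#{α > 0 : g⁻¹α < 0} = n(g⁻¹) = ℓ(g)`.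
[cite: IwahoriMatsumoto1965, §1.6 Proposition 1.23 and proof of Proposition 1.25 ("λ(T(d)w*w) = λ(T(d)w*) − n(w)")] -/
theorem length_constVAdd_mul_affineHom_add_of_regular_dominant [Nonempty ι] [DecidablePred b.IsPos] {η : ι}
    (hη : ∀ k, P.coroot η - P.coroot k ∈ AddSubmonoid.closure (P.coroot '' (b.support : Set ι))) {g : P.Aut} (hg : g ∈ P.weylGroup)
    {d : M} (hd : d ∈ P.rootSpan ℤ) {m : ι → ℤ} (hm : ∀ i, P.coroot' i d = m i) (hreg : ∀ i, b.IsPos i → 1 ≤ m i) :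
    PreCoxeterSystem.length (wallReflection b η)
        ⟨AffineEquiv.constVAdd K M d * affineHom P g,
          Subgroup.mul_mem _ (constVAdd_mem_affineWeylGroup_of_mem_rootSpan P hd) (affineHom_mem_affineWeylGroup P hg)⟩ +
      PreCoxeterSystem.length (wallReflection b η) ⟨affineHom P g, affineHom_mem_affineWeylGroup P hg⟩ =
        PreCoxeterSystem.length (wallReflection b η)
          ⟨AffineEquiv.constVAdd K M d, constVAdd_mem_affineWeylGroup_of_mem_rootSpan P hd⟩ := by
  have hg' : g⁻¹ ∈ P.weylGroup := Subgroup.inv_mem _ hg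
  have h1 := length_constVAdd_mul_affineHom_eq b hη hd hg hm
  have h2 : ∀ i ∈ Finset.univ.filter b.IsPos, (if b.IsPos (g⁻¹ • i) then |m i| else |m i - 1|) =
      m i - (if ¬ b.IsPos (g⁻¹ • i) then 1 else 0) := by
    intro i hi
    have h0 := hreg i (Finset.mem_filter.mp hi).2
    by_cases hgi : b.IsPos (g⁻¹ • i)
    · rw [if_pos hgi, if_neg (not_not.mpr hgi), abs_of_nonneg (by linarith), sub_zero]
    · rw [if_neg hgi, if_pos hgi, abs_of_nonneg (by linarith)]
  rw [Finset.sum_congr rfl h2, Finset.sum_sub_distrib] at h1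
  have h3 : (∑ i ∈ Finset.univ.filter b.IsPos, (if ¬ b.IsPos (g⁻¹ • i) then (1 : ℤ) else 0)) =
      (((Finset.univ.filter b.IsPos).filter (fun i ↦ ¬ b.IsPos (g⁻¹ • i))).card : ℤ) := by
    rw [Finset.card_filter, Nat.cast_sum]
    exact Finset.sum_congr rfl fun i _ ↦ by split_ifs <;> simp
  -- `n(g⁻¹) = ℓ(g⁻¹) = ℓ(g)`
  have hinv : (⟨affineHom P g⁻¹, affineHom_mem_affineWeylGroup P hg'⟩ : affineWeylGroup P) =
      ⟨affineHom P g, affineHom_mem_affineWeylGroup P hg⟩⁻¹ := by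
    apply Subtype.ext
    rw [Subgroup.coe_inv]
    show affineHom P g⁻¹ = (affineHom P g)⁻¹
    rw [map_inv]
  have h4 := length_affineHom_eq_card_filter b hη hg'
  rw [hinv, (isPreCoxeterSystem_affineWeylGroup b hη).length_inv] at h4
  rw [h3] at h1
  have h5 := length_constVAdd_eq_sum_of_dominant b hη hd hm fun i hi ↦ (by linarith [hreg i hi])
  have h6 : (PreCoxeterSystem.length (wallReflection b η)
        ⟨AffineEquiv.constVAdd K M d * affineHom P g,
          Subgroup.mul_mem _ (constVAdd_mem_affineWeylGroup_of_mem_rootSpan P hd) (affineHom_mem_affineWeylGroup P hg)⟩ : ℤ) +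
      PreCoxeterSystem.length (wallReflection b η) ⟨affineHom P g, affineHom_mem_affineWeylGroup P hg⟩ =
        PreCoxeterSystem.length (wallReflection b η)
          ⟨AffineEquiv.constVAdd K M d, constVAdd_mem_affineWeylGroup_of_mem_rootSpan P hd⟩ := by
    rw [h1, h4, h5]; ring
  exact_mod_cast h6

end RightW

end Base

end Literature.LinearAlgebra.RootSystem
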